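import Literature.AlgebraicGeometry.Resolution.RegularLocalRingsQuotient
import Literature.AlgebraicGeometry.Resolution.SubschemeRegularStalks
import Literature.AlgebraicGeometry.Resolution.MarkedIdeals
import Literature.AlgebraicGeometry.Resolution.EffectiveCartierStalks
import HarnessLib

/-!
# [OURS · L1 W4.5(b) · EL♮ · RUNG LC «large characteristic», de-risk brick LC-ORD1] A HYPERSURFACE OF ORDER ONE IN A REGULAR SCHEME IS REGULAR
# (global `I.subscheme` form)

res-L1-w45b-stub-4 g17 (STUB WORKER 4; desk ★★ R94 of 2026-08-29 «NAMED WORK for stub-4 g17 = RUNG LC DE-RISK BRICKS: (2) LC-ORD1 GLOBAL»; shape by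
res-L1-w45b-idea-2 g32 (memo `Cruxes/EquisingularLiftNatThree/LARGE-CHAR-RUNG-idea2.md` v1.1 ada089db502dd96d §5 (r7)) and res-L1-w45b-lead-2 g10 (by-name
input 2026-08-29T15:52:59Z: the affine-chart form is ✓ `isRegular_hypersurface_of_order_one`, MaximalContact :243).  Crux context EL♮(3) =
stmt-ResolutionOfSingularities-20148 (parent EL♮ stmt-…-20038; bookkeeping crux stmt-…-15660).  OURS; NOT a statement of any manuscript ([Hironaka2017] is a
candidate under adjudication, nothing of it is asserted or imported); AI-written, weaker than expert review.  DEF-FREE; no `sorry`; standard axioms;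
Literature/Resolution vocabulary only (import-clean: no campaign cone); `--supports stmt-…-20148 --as helper`, counted 0.  EL♮(3) / EL♮ / `EquisingularLift`
NOT proved.

WHAT (the END clause of the rung's step (B2): after the last order-reduction round the strict transform of the hypersurface has maximal order `≤ 1`,
hence is regular).  `W` locally Noetherian and regular, `I` an ideal sheaf with every stalk principal («hypersurface»):
* `LargeChar.isRegularLocalRing_quotient_stalkIdeal_of_idealOrder_eq_one` — at a point `x` with `ord_x I = 1` the quotient `𝒪_{W,x}/I_x` is a regular
  local ring (`I_x = (t)`, `t ∈ 𝔪_x ∖ 𝔪_x²`; Matsumura Thm. 14.2, tree ✓ `IsRegularLocalRing.quotient_span_singleton`);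
* ★ `LargeChar.isRegular_subscheme_of_idealOrder_eq_one` — if `ord_x I = 1` at every point of `V(I)` then the closed subscheme `V(I) = I.subscheme` is
  regular (✓ `Scheme.isRegular_subscheme_of_forall`); `…_of_idealOrder_le_one` — the same from «`ord_x I ≤ 1` everywhere» (the output
  `cosupp(I, 2) = ∅` of a Kollár round with marking `2`); `…_of_isEffectiveCartier` — effective-Cartier phrasing.
[cite: Matsumura1987, Thm. 14.2] [cite: BierstoneGrigorievMilmanWlodarczyk2011, Lemma 3.6.4 (1)] (method; index only).
-/

set_option linter.dupNamespace false -- mandated namespace `Summit.<Summit>.<Problem>` of this single-conjunct summit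

noncomputable section

open CategoryTheory CategoryTheory.Limits AlgebraicGeometry TopologicalSpace Topology IsLocalRing
open Literature.AlgebraicGeometry.Resolution
open AlgebraicGeometry.Scheme.IdealSheafData

namespace Summit.ResolutionOfSingularities.ResolutionOfSingularities.Cruxes.EquisingularLiftNat.Sections

namespace LargeChar

universe u

variable {W : Scheme.{u}} {I : W.IdealSheafData}

/-- **Order one at a point ⇒ regular quotient stalk.**  If `𝒪_{W,x}` is regular, `I_x` is principal and `ord_x I = 1`, then `𝒪_{W,x}/I_x` is a regular
local ring: `I_x = (t)` with `t ∈ 𝔪_x` (order `≥ 1`) and `t ∉ 𝔪_x²` (order `< 2`). [cite: Matsumura1987, Thm. 14.2] -/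
theorem isRegularLocalRing_quotient_stalkIdeal_of_idealOrder_eq_one {x : W} [IsRegularLocalRing (W.presheaf.stalk x)]
    (hI : (stalkIdeal I x).IsPrincipal) (h1 : idealOrder I x = 1) :
    IsRegularLocalRing (W.presheaf.stalk x ⧸ stalkIdeal I x) := by
  obtain ⟨t, ht⟩ := (Submodule.isPrincipal_iff _).mp hI
  have ht' : stalkIdeal I x = Ideal.span {t} := ht
  have htm : t ∈ maximalIdeal (W.presheaf.stalk x) := by
    have hle : stalkIdeal I x ≤ maximalIdeal (W.presheaf.stalk x) ^ 1 := by
      rw [← le_idealOrder_iff, h1]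
      exact_mod_cast le_rfl
    rw [pow_one, ht'] at hle
    exact hle (Ideal.mem_span_singleton_self t)
  have ht2 : t ∉ maximalIdeal (W.presheaf.stalk x) ^ 2 := by
    intro ht2
    have hle : stalkIdeal I x ≤ maximalIdeal (W.presheaf.stalk x) ^ 2 := by
      rw [ht']
      exact (Ideal.span_singleton_le_iff_mem _).mpr ht2
    rw [← le_idealOrder_iff, h1] at hle
    exact absurd (by exact_mod_cast hle) (by norm_num : ¬ (2 : ℕ) ≤ 1)
  rw [ht']
  exact (IsRegularLocalRing.quotient_span_singleton htm ht2).1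

/-- ★ **LC-ORD1 GLOBAL — a hypersurface of order one in a regular scheme is regular.**  `W` locally Noetherian and regular, `I` an ideal sheaf with
principal stalks and `ord_x I = 1` at every point of `V(I)`: the closed subscheme `V(I)` is regular. [cite: Matsumura1987, Thm. 14.2] -/
theorem isRegular_subscheme_of_idealOrder_eq_one [IsLocallyNoetherian W] (hW : Scheme.IsRegular W)
    (hI : ∀ x, (stalkIdeal I x).IsPrincipal) (h1 : ∀ x ∈ I.support, idealOrder I x = 1) :
    Scheme.IsRegular I.subscheme := by
  refine Scheme.isRegular_subscheme_of_forall I fun x hx => ?_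
  haveI : IsRegularLocalRing (W.presheaf.stalk x) := hW x
  exact isRegularLocalRing_quotient_stalkIdeal_of_idealOrder_eq_one (hI x) (h1 x hx)

/-- **LC-ORD1 from «maximal order ≤ 1»** (the output `cosupp(I, 2) = ∅` of the last Kollár round): on the support the order is `≥ 1`, hence `= 1`.
[cite: Matsumura1987, Thm. 14.2] -/
theorem isRegular_subscheme_of_idealOrder_le_one [IsLocallyNoetherian W] (hW : Scheme.IsRegular W)
    (hI : ∀ x, (stalkIdeal I x).IsPrincipal) (h1 : ∀ x : W, idealOrder I x ≤ 1) :
    Scheme.IsRegular I.subscheme := by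
  refine isRegular_subscheme_of_idealOrder_eq_one hW hI fun x hx => le_antisymm (h1 x) ?_
  have := (one_le_idealOrder_iff I x).mpr hx
  exact_mod_cast this

/-- **LC-ORD1, effective-Cartier phrasing**: an effective Cartier ideal of order `≤ 1` everywhere on a regular locally Noetherian scheme cuts out a
regular closed subscheme. [cite: Matsumura1987, Thm. 14.2] -/
theorem isRegular_subscheme_of_isEffectiveCartier_of_idealOrder_le_one [IsLocallyNoetherian W] (hW : Scheme.IsRegular W)
    (hI : IsEffectiveCartier I) (h1 : ∀ x : W, idealOrder I x ≤ 1) : Scheme.IsRegular I.subscheme := by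
  refine isRegular_subscheme_of_idealOrder_le_one hW (fun x => ?_) h1
  obtain ⟨t, -, ht⟩ := hI.exists_stalkIdeal_eq_span x
  rw [ht]
  exact ⟨⟨t, rfl⟩⟩

end LargeChar

end Summit.ResolutionOfSingularities.ResolutionOfSingularities.Cruxes.EquisingularLiftNat.Sections

end
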